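import Literature.Analysis.FluidPDE.TypeIAncientMild
import Summits.NavierStokesRegularity.NavierStokesRegularity.Theorems.ClockStretchingLawSteadySliceLiouvilleAnalytic
import HarnessLib

/-!
# Route ClockStretchingLaw — crux `ClockCeiling`, line `registered`: derivatives of pointwise
# limits under uniform second-derivative bounds

Helper file for the lead's stub `stub_zoomCompactness` of the reshaped skeleton of crux
`ClockCeiling` (item stmt-NavierStokesRegularity-10570). KNSS 2009 Lemma 6.1 delivers the zoom
limit of a Type-I ancient mild field only as a pointwise / locally uniform limit of the FIELDS;
the clock mode `∂ₜu` and the translation modes `∂_b u` of the frame form need the convergence of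
first DERIVATIVES at every point. This file supplies the elementary real-analysis step: if
`fₙ → g` pointwise on `[t, t + r]`, the derivatives `fₙ'` are uniformly Lipschitz at `t`
(`‖fₙ'(s) - fₙ'(t)‖ ≤ L (s - t)`), and `g` is differentiable at `t`, then `fₙ'(t) → g'(t)`
(`tendsto_deriv_of_forall_lipschitz`: a two-point difference quotient with a step `h₀` chosen
once). Applied along time curves (Lipschitz constant from a uniform bound on `∂ₜ²`) and along
lines in space (from a uniform bound on `∇²`, by the mean value inequality for `y ↦ Du(t)(y)`),
it gives `∂ₜuₙ(t,x) → ∂ₜU(t,x)` and `Duₙ(t)(x) e → DU(t)(x) e` for sequences of Type-I ancient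
mild fields with the scale-invariant bounds of `stub_uniformBounds` converging pointwise to a
Type-I ancient mild field (`tendsto_timeDeriv_of_typeI`, `tendsto_fderiv_apply_of_typeI`).

## References

* G. Koch, N. Nadirashvili, G. Seregin, V. Šverák, Acta Math. 203 (2009) = arXiv:0709.3599,
  Lemma 6.1 and Prop. 4.1 (the uniform derivative bounds behind the compactness).
-/

set_option linter.dupNamespace false

noncomputable section

open Literature.Analysis.FluidPDE MeasureTheory Set Function Filter Topology Metric
open scoped ENNReal NNReal

namespace Summit.NavierStokesRegularity.NavierStokesRegularity.Theorems

/-! ### The elementary lemma -/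

section Elementary

variable {F : Type*} [NormedAddCommGroup F] [NormedSpace ℝ F]

/-- **One-sided Taylor bound from a Lipschitz derivative**: if `f` has derivative `f'` on
`[t, t + r]` with `‖f'(s) - f'(t)‖ ≤ L (s - t)` there, then
`‖f(t+h) - f(t) - h • f'(t)‖ ≤ L h²` for `0 < h ≤ r`. -/
theorem norm_sub_sub_smul_le_of_lipschitz_deriv {f f' : ℝ → F} {t r L : ℝ} (hL : 0 ≤ L)
    (hder : ∀ s ∈ Icc t (t + r), HasDerivAt f (f' s) s)
    (hlip : ∀ s ∈ Icc t (t + r), ‖f' s - f' t‖ ≤ L * (s - t)) {h : ℝ} (hh : 0 < h) (hhr : h ≤ r) :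
    ‖f (t + h) - f t - h • f' t‖ ≤ L * h * h := by
  -- `G s = f s - s • f' t` has derivative `f' s - f' t`, bounded by `L h` on `[t, t + h]`
  have hG : ∀ s ∈ Icc t (t + h), HasDerivWithinAt (fun σ => f σ - σ • f' t) (f' s - f' t)
      (Icc t (t + h)) s := fun s hs =>
    ((hder s ⟨hs.1, hs.2.trans (by linarith)⟩).sub ((hasDerivAt_id s).smul_const (f' t))
      |>.hasDerivWithinAt).congr_deriv (by simp)
  have hB : ∀ s ∈ Ico t (t + h), ‖f' s - f' t‖ ≤ L * h := fun s hs =>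
    (hlip s ⟨hs.1, hs.2.le.trans (by linarith)⟩).trans
      (mul_le_mul_of_nonneg_left (by linarith [hs.2.le]) hL)
  have key := norm_image_sub_le_of_norm_deriv_le_segment' hG hB (t + h) ⟨by linarith, le_rfl⟩
  have e : (f (t + h) - (t + h) • f' t) - (f t - t • f' t) = f (t + h) - f t - h • f' t := by
    rw [add_smul]; abel
  rw [e, show t + h - t = h by ring] at key
  exact key

/-- **Derivatives of pointwise limits under a uniform Lipschitz bound on the derivatives.**
If `fₙ → g` pointwise on `[t, t + r]` (`r > 0`), each `fₙ` has derivative `fₙ'` there with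
`‖fₙ'(s) - fₙ'(t)‖ ≤ L (s - t)` (one constant `L` for all `n`), and `g` has derivative `d` at
`t`, then `fₙ'(t) → d`. Proof: for a step `h₀ ∈ (0, r]` chosen with `L h₀ < ε/3` and the
difference quotient of `g` within `ε/3` of `d`, the difference quotients of `fₙ` at step `h₀`
converge to that of `g` and are within `L h₀` of `fₙ'(t)`. -/
theorem tendsto_deriv_of_forall_lipschitz {f : ℕ → ℝ → F} {f' : ℕ → ℝ → F} {g : ℝ → F}
    {d : F} {t r L : ℝ} (hr : 0 < r)
    (hder : ∀ n, ∀ s ∈ Icc t (t + r), HasDerivAt (f n) (f' n s) s)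
    (hlip : ∀ n, ∀ s ∈ Icc t (t + r), ‖f' n s - f' n t‖ ≤ L * (s - t))
    (hpt : ∀ s ∈ Icc t (t + r), Tendsto (fun n => f n s) atTop (𝓝 (g s)))
    (hg : HasDerivAt g d t) :
    Tendsto (fun n => f' n t) atTop (𝓝 d) := by
  have hL : 0 ≤ L := by
    have h := hlip 0 (t + r) ⟨by linarith, le_rfl⟩
    have h0 : 0 ≤ ‖f' 0 (t + r) - f' 0 t‖ := norm_nonneg _
    nlinarith
  rw [Metric.tendsto_atTop]
  intro ε hε
  -- the difference quotients of `g` from the right tend to `d`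
  have hslope : Tendsto (fun h : ℝ => h⁻¹ • (g (t + h) - g t)) (𝓝[>] 0) (𝓝 d) :=
    (hasDerivAt_iff_tendsto_slope_zero.1 hg).mono_left (nhdsWithin_mono _ fun h hh => ne_of_gt hh)
  have hev : ∀ᶠ h : ℝ in 𝓝[>] 0, dist (h⁻¹ • (g (t + h) - g t)) d < ε / 3 ∧ (0 < h ∧ h ≤ r) ∧
      L * h < ε / 3 := by
    have h2 : ∀ᶠ h : ℝ in 𝓝[>] (0 : ℝ), 0 < h ∧ h ≤ r := Ioc_mem_nhdsGT hr
    refine (Metric.tendsto_nhds.1 hslope (ε / 3) (by positivity)).and (h2.and ?_)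
    have hc : Tendsto (fun h : ℝ => L * h) (𝓝[>] 0) (𝓝 (L * 0)) :=
      ((continuous_const.mul continuous_id).tendsto 0).mono_left nhdsWithin_le_nhds
    rw [mul_zero] at hc
    exact (Metric.tendsto_nhds.1 hc (ε / 3) (by positivity)).mono fun h hh => by
      rw [Real.dist_eq, sub_zero] at hh
      exact lt_of_abs_lt hh
  obtain ⟨h₀, hD, ⟨hh₀, hh₀r⟩, hLh⟩ := hev.exists
  -- pointwise convergence at `t` and `t + h₀`
  set δ : ℝ := ε * h₀ / 9 with hδ
  have hδ0 : 0 < δ := by positivity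
  have h1 := Metric.tendsto_atTop.1 (hpt t ⟨le_rfl, by linarith⟩) δ hδ0
  have h2 := Metric.tendsto_atTop.1 (hpt (t + h₀) ⟨by linarith, by linarith⟩) δ hδ0
  obtain ⟨N₁, hN₁⟩ := h1
  obtain ⟨N₂, hN₂⟩ := h2
  refine ⟨max N₁ N₂, fun n hn => ?_⟩
  have hn1 := hN₁ n (le_of_max_le_left hn)
  have hn2 := hN₂ n (le_of_max_le_right hn)
  -- the three pieces
  set Dn : F := h₀⁻¹ • (f n (t + h₀) - f n t) with hDn
  set D : F := h₀⁻¹ • (g (t + h₀) - g t) with hDdef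
  have hA : ‖f' n t - Dn‖ ≤ L * h₀ := by
    have hT := norm_sub_sub_smul_le_of_lipschitz_deriv hL (hder n) (hlip n) hh₀ hh₀r
    have e : f' n t - Dn = h₀⁻¹ • (h₀ • f' n t - (f n (t + h₀) - f n t)) := by
      simp only [hDn, smul_sub, smul_smul, inv_mul_cancel₀ hh₀.ne', one_smul]
    rw [e, norm_smul, norm_inv, Real.norm_of_nonneg hh₀.le, ← norm_neg,
      show -(h₀ • f' n t - (f n (t + h₀) - f n t)) = f n (t + h₀) - f n t - h₀ • f' n t by abel]
    calc h₀⁻¹ * ‖f n (t + h₀) - f n t - h₀ • f' n t‖ ≤ h₀⁻¹ * (L * h₀ * h₀) :=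
          mul_le_mul_of_nonneg_left hT (inv_nonneg.2 hh₀.le)
      _ = L * h₀ := by field_simp
  have hB : ‖Dn - D‖ < ε / 3 := by
    have e : Dn - D = h₀⁻¹ • ((f n (t + h₀) - g (t + h₀)) - (f n t - g t)) := by
      rw [hDn, hDdef, ← smul_sub]; congr 1; abel
    rw [e, norm_smul, norm_inv, Real.norm_of_nonneg hh₀.le]
    have h3 : ‖(f n (t + h₀) - g (t + h₀)) - (f n t - g t)‖ < 2 * δ := by
      calc ‖(f n (t + h₀) - g (t + h₀)) - (f n t - g t)‖
          ≤ ‖f n (t + h₀) - g (t + h₀)‖ + ‖f n t - g t‖ := norm_sub_le _ _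
        _ < δ + δ := by rw [← dist_eq_norm, ← dist_eq_norm]; exact add_lt_add hn2 hn1
        _ = 2 * δ := by ring
    calc h₀⁻¹ * ‖(f n (t + h₀) - g (t + h₀)) - (f n t - g t)‖ < h₀⁻¹ * (2 * δ) :=
          mul_lt_mul_of_pos_left h3 (inv_pos.2 hh₀)
      _ = 2 * ε / 9 := by rw [hδ]; field_simp
      _ < ε / 3 := by linarith
  have hC : ‖D - d‖ < ε / 3 := by rwa [← dist_eq_norm]
  calc dist (f' n t) d = ‖(f' n t - Dn) + (Dn - D) + (D - d)‖ := by
        rw [dist_eq_norm]; congr 1; abel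
    _ ≤ ‖f' n t - Dn‖ + ‖Dn - D‖ + ‖D - d‖ := norm_add₃_le
    _ < ε / 3 + ε / 3 + ε / 3 := by linarith
    _ = ε := by ring

end Elementary

/-! ### Application to sequences of Type-I ancient mild fields -/

section TypeI

variable {C K : ℝ} {w : ℕ → ℝ → (EuclideanSpace ℝ (Fin 3)) → (EuclideanSpace ℝ (Fin 3))}
  {W : ℝ → (EuclideanSpace ℝ (Fin 3)) → (EuclideanSpace ℝ (Fin 3))}

/-- Monotonicity of the scale-invariant majorants: for `t ≤ σ ≤ t/2 < 0` and `p ≤ 0`,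
`(-σ)^p ≤ (-(t/2))^p`. -/
theorem rpow_neg_le_of_le_half {t σ p : ℝ} (ht : t < 0) (hσ : σ ≤ t / 2) (hp : p ≤ 0) :
    (-σ) ^ p ≤ (-(t / 2)) ^ p :=
  Real.rpow_le_rpow_of_nonpos (by linarith) (by linarith) hp

/-- **Convergence of the clock mode.** Let `wₙ` be Type-I ancient mild fields converging
pointwise on `(-∞,0) × ℝ³` to a Type-I ancient mild field `W`, with a uniform scale-invariant
bound `‖∂ₜ²wₙ(t,x)‖ ≤ K (-t)^{-5/2}`. Then `∂ₜwₙ(t,x) → ∂ₜW(t,x)` for every `t < 0` and `x`. -/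
theorem tendsto_timeDeriv_of_typeI (hw : ∀ n, IsTypeIAncientMild C (w n))
    (hW : IsTypeIAncientMild C W)
    (hpt : ∀ t < 0, ∀ x, Tendsto (fun n => w n t x) atTop (𝓝 (W t x)))
    (h2t : ∀ n, ∀ t < 0, ∀ x, ‖iteratedDeriv 2 (fun s => w n s x) t‖ ≤ K * (-t) ^ (-(5 : ℝ) / 2))
    {t : ℝ} (ht : t < 0) (x : EuclideanSpace ℝ (Fin 3)) :
    Tendsto (fun n => timeDeriv (w n) t x) atTop (𝓝 (timeDeriv W t x)) := by
  set r : ℝ := -t / 2 with hr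
  have hr0 : 0 < r := by rw [hr]; linarith
  have htr : t + r = t / 2 := by rw [hr]; ring
  set L : ℝ := K * (-(t / 2)) ^ (-(5 : ℝ) / 2) with hL
  have hcurve : ∀ n, ∀ s < 0, HasDerivAt (fun τ => w n τ x) (deriv (fun τ => w n τ x) s) s ∧
      HasDerivAt (deriv fun τ => w n τ x) (iteratedDeriv 2 (fun τ => w n τ x) s) s :=
    fun n s hs => steadySlice_hasDerivAt_curve (hw n).contDiffOn x hs
  simp only [timeDeriv_apply]
  refine tendsto_deriv_of_forall_lipschitz (f := fun n s => w n s x)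
    (f' := fun n s => deriv (fun τ => w n τ x) s) (g := fun s => W s x) (L := L) hr0
    (fun n s hs => (hcurve n s (by rw [htr] at hs; linarith [hs.2])).1) (fun n s hs => ?_)
    (fun s hs => hpt s (by rw [htr] at hs; linarith [hs.2]) x)
    (steadySlice_hasDerivAt_curve hW.contDiffOn x ht).1
  -- the Lipschitz bound from the mean value inequality for `deriv` with `‖∂ₜ²‖ ≤ L` on `[t, t/2]`
  rw [htr] at hs
  have hmv := norm_image_sub_le_of_norm_deriv_le_segment' (f := deriv fun τ => w n τ x)
    (f' := iteratedDeriv 2 fun τ => w n τ x) (a := t) (b := t / 2) (C := L)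
    (fun σ hσ => (hcurve n σ (by linarith [hσ.2])).2.hasDerivWithinAt)
    (fun σ hσ => (h2t n σ (by linarith [hσ.2]) x).trans ?_) s hs
  · exact hmv
  · have hK : 0 ≤ K := by
      have h := h2t n σ (by linarith [hσ.2]) x
      have hpos : 0 < (-σ) ^ (-(5 : ℝ) / 2) := Real.rpow_pos_of_pos (by linarith [hσ.2]) _
      nlinarith [norm_nonneg (iteratedDeriv 2 (fun s => w n s x) σ)]
    exact mul_le_mul_of_nonneg_left (rpow_neg_le_of_le_half ht hσ.2.le (by norm_num)) hK

/-- `‖D(Df)(y)‖ = ‖D²f(y)‖` (Mathlib's curried and uncurried second derivatives have the same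
norm). -/
theorem norm_fderiv_fderiv_eq_norm_iteratedFDeriv_two {E G : Type*} [NormedAddCommGroup E]
    [NormedSpace ℝ E] [NormedAddCommGroup G] [NormedSpace ℝ G] (f : E → G) (y : E) :
    ‖fderiv ℝ (fderiv ℝ f) y‖ = ‖iteratedFDeriv ℝ 2 f y‖ := by
  rw [← norm_iteratedFDeriv_one, norm_iteratedFDeriv_fderiv]

/-- **Convergence of the translation modes.** Let `wₙ` be Type-I ancient mild fields converging
pointwise on `(-∞,0) × ℝ³` to a Type-I ancient mild field `W`, with a uniform scale-invariant
bound `‖∇²wₙ(t,x)‖ ≤ K (-t)^{-3/2}`. Then `Dwₙ(t)(x) e → DW(t)(x) e` for every `t < 0`, `x`, `e`. -/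
theorem tendsto_fderiv_apply_of_typeI (hw : ∀ n, IsTypeIAncientMild C (w n))
    (hW : IsTypeIAncientMild C W)
    (hpt : ∀ t < 0, ∀ x, Tendsto (fun n => w n t x) atTop (𝓝 (W t x)))
    (h2x : ∀ n, ∀ t < 0, ∀ x, ‖iteratedFDeriv ℝ 2 (w n t) x‖ ≤ K * (-t) ^ (-(3 : ℝ) / 2))
    {t : ℝ} (ht : t < 0) (x e : EuclideanSpace ℝ (Fin 3)) :
    Tendsto (fun n => fderiv ℝ (w n t) x e) atTop (𝓝 (fderiv ℝ (W t) x e)) := by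
  set M : ℝ := K * (-t) ^ (-(3 : ℝ) / 2) with hM
  -- slices are smooth; lines are differentiable
  have hF : ∀ n, ContDiff ℝ 2 (w n t) := fun n => ((hw n).contDiff_slice ht).of_le (by norm_cast)
  have hline : ∀ ρ : ℝ, HasDerivAt (fun σ : ℝ => x + σ • e) e ρ := fun ρ => by
    simpa using ((hasDerivAt_id ρ).smul_const e).const_add x
  have hder : ∀ n (ρ : ℝ), HasDerivAt (fun σ : ℝ => w n t (x + σ • e))
      (fderiv ℝ (w n t) (x + ρ • e) e) ρ := fun n ρ =>
    (((hF n).differentiable (by norm_num)) (x + ρ • e)).hasFDerivAt.comp_hasDerivAt ρ (hline ρ)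
  -- mean value for `y ↦ D(wₙ t)(y)` with `‖D²‖ ≤ M`
  have hlipF : ∀ n (ρ : ℝ), 0 ≤ ρ →
      ‖fderiv ℝ (w n t) (x + ρ • e) e - fderiv ℝ (w n t) x e‖ ≤ M * ‖e‖ ^ 2 * (ρ - 0) := by
    intro n ρ hρ
    have hd1 : Differentiable ℝ (fderiv ℝ (w n t)) :=
      ((hF n).fderiv_right (m := 1) (by norm_num)).differentiable one_ne_zero
    have hmv := Convex.norm_image_sub_le_of_norm_fderiv_le (f := fderiv ℝ (w n t))
      (fun y _ => hd1 y) (fun y _ => by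
        rw [norm_fderiv_fderiv_eq_norm_iteratedFDeriv_two]
        exact h2x n t ht y) convex_univ (mem_univ x) (mem_univ (x + ρ • e))
    rw [add_sub_cancel_left, norm_smul, Real.norm_of_nonneg hρ] at hmv
    have e1 : fderiv ℝ (w n t) (x + ρ • e) e - fderiv ℝ (w n t) x e =
        (fderiv ℝ (w n t) (x + ρ • e) - fderiv ℝ (w n t) x) e := rfl
    rw [e1]
    calc ‖(fderiv ℝ (w n t) (x + ρ • e) - fderiv ℝ (w n t) x) e‖
        ≤ ‖fderiv ℝ (w n t) (x + ρ • e) - fderiv ℝ (w n t) x‖ * ‖e‖ :=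
          ContinuousLinearMap.le_opNorm _ _
      _ ≤ M * (ρ * ‖e‖) * ‖e‖ := mul_le_mul_of_nonneg_right hmv (norm_nonneg _)
      _ = M * ‖e‖ ^ 2 * (ρ - 0) := by ring
  have hlim := tendsto_deriv_of_forall_lipschitz (f := fun n (σ : ℝ) => w n t (x + σ • e))
    (f' := fun n (ρ : ℝ) => fderiv ℝ (w n t) (x + ρ • e) e) (g := fun σ : ℝ => W t (x + σ • e))
    (t := 0) (r := 1) one_pos (fun n ρ _ => hder n ρ)
    (fun n ρ hρ => by simpa only [zero_add, zero_smul, add_zero] using hlipF n ρ hρ.1)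
    (fun σ _ => hpt t ht (x + σ • e)) (d := fderiv ℝ (W t) x e) (by
      have h : HasDerivAt (fun σ : ℝ => W t (x + σ • e)) (fderiv ℝ (W t) (x + (0 : ℝ) • e) e) 0 :=
        ((hW.contDiff_slice ht).differentiable (by simp) (x + (0 : ℝ) • e)).hasFDerivAt
          |>.comp_hasDerivAt (0 : ℝ) (hline 0)
      simpa only [zero_smul, add_zero] using h)
  simpa only [zero_smul, add_zero] using hlim


/-! ### Registered sub-goal of `stub_zoomCompactness` -/

/-- **Convergence of the clock and translation modes along a pointwise-convergent sequence of
Type-I ancient mild fields with uniform scale-invariant second-derivative bounds** (the two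
applications packaged; registered sub-goal `zoomModes_tendsto` of `stub_zoomCompactness`). -/
theorem zoomModes_tendsto :
    ∀ (C K : ℝ) (w : ℕ → ℝ → EuclideanSpace ℝ (Fin 3) → EuclideanSpace ℝ (Fin 3)) (W : ℝ → EuclideanSpace ℝ (Fin 3) → EuclideanSpace ℝ (Fin 3)), (∀ n, Literature.Analysis.FluidPDE.IsTypeIAncientMild C (w n)) → Literature.Analysis.FluidPDE.IsTypeIAncientMild C W → (∀ t : ℝ, t < 0 → ∀ x, Filter.Tendsto (fun n => w n t x) Filter.atTop (nhds (W t x))) → (∀ n, ∀ t : ℝ, t < 0 → ∀ x, ‖iteratedDeriv 2 (fun s => w n s x) t‖ ≤ K * (-t) ^ (-(5 : ℝ) / 2)) → (∀ n, ∀ t : ℝ, t < 0 → ∀ x, ‖iteratedFDeriv ℝ 2 (w n t) x‖ ≤ K * (-t) ^ (-(3 : ℝ) / 2)) → ∀ t : ℝ, t < 0 → ∀ (x e : EuclideanSpace ℝ (Fin 3)), Filter.Tendsto (fun n => Literature.Analysis.FluidPDE.timeDeriv (w n) t x) Filter.atTop (nhds (Literature.Analysis.FluidPDE.timeDeriv W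 t x)) ∧ Filter.Tendsto (fun n => fderiv ℝ (w n t) x e) Filter.atTop (nhds (fderiv ℝ (W t) x e)) :=
  fun _ _ _ _ hw hW hpt h2t h2x _ ht x e =>
    ⟨tendsto_timeDeriv_of_typeI hw hW hpt h2t ht x, tendsto_fderiv_apply_of_typeI hw hW hpt h2x ht x e⟩

end TypeI

end Summit.NavierStokesRegularity.NavierStokesRegularity.Theorems

end
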